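import Summits.BirchSwinnertonDyer.BirchSwinnertonDyer.Theses.PrintX8VSC
import HarnessLib

/-!
# Route `PrintX8VSC` (rev 4), item stmt-BirchSwinnertonDyer-23779 `RankOneLinkOfPrintX8ContraOfParts` — the GLUE of the split of
# 23745 `RankOneLinkOfPrintX8Contra` (gen 1): child 1 → child 2 → parent, i.e. modus ponens

TURNKEY closer prepared by the x8 planner (bsd-print-x8-plan g34; a PROVER seat files this with
`ledger propose --kind proof --target Summits/BirchSwinnertonDyer/BirchSwinnertonDyer/Theorems/PrintX8VSCRankOneLinkOfPrintX8ContraOfParts.lean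
--file <this> --workitem stmt-BirchSwinnertonDyer-23779`). HONEST FRAMING: pure logic —
`InputBKOCorA5SharpFlatContra → RankOneLinkOfPrintX8ContraOfBKO → RankOneLinkOfPrintX8Contra` where the middle statement is
`InputBKOCorA5SharpFlatContra → RankOneLinkOfPrintX8Contra`. Nothing about any curve is proved; PARTITION 0.

References: route file `Theses/PrintX8VSC.lean` (rev 4, items 23745 / 23772 / 23773 / 23779).
-/

set_option autoImplicit false
-- justification: the mandated namespace `Summit.BirchSwinnertonDyer.BirchSwinnertonDyer.Theorems`
-- (single-conjunct summit, Sub = Summit) repeats a segment by design (D-0017).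
set_option linter.dupNamespace false

namespace Summit.BirchSwinnertonDyer.BirchSwinnertonDyer.Theorems.PrintX8VSCGlue

open Summit.BirchSwinnertonDyer.BirchSwinnertonDyer.Theses.PrintX8VSC

/-- **Item stmt-BirchSwinnertonDyer-23779 `PrintX8VSC.RankOneLinkOfPrintX8ContraOfParts` holds**: child 2 (the rank-one link GIVEN
the print-keyed BKO input) applied to child 1 (that input) gives the parent `RankOneLinkOfPrintX8Contra` — modus ponens. Closes this
item only. -/
theorem rankOneLinkOfPrintX8ContraOfParts_holds : RankOneLinkOfPrintX8ContraOfParts := fun hBKO hLink1g => hLink1g hBKO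

end Summit.BirchSwinnertonDyer.BirchSwinnertonDyer.Theorems.PrintX8VSCGlue
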